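import Mathlib
import HarnessLib
import Summits.ValiantsHypothesis.ValiantsHypothesis.Theorems.LacunarySymmetroidMatrixDescartesOsculationLawCuspCubic

/-!
# ValiantsHypothesis / LacunarySymmetroid — crux `MatrixDescartes` (stmt-ValiantsHypothesis-18050, V1),
# line «osculation-law»: the NON-MONIC cubic cusp curve `a₃b³ + a₂b² + a₁b + a₀` — θ-calculus and pseudo-division

Algebra for the count half (β) of the rank-three column `(3, s)` (val-lit-p5 g11's programme), for ARBITRARY
`a₃ a₂ a₁ a₀ : ℝ[X]` (no definitions, no named facts):

* `eval_Psi3`, `eval_logHessian_Psi3` — θ-calculus for `Ψ = X₁³·ι a₃ + X₁²·ι a₂ + X₁·ι a₁ + ι a₀` (`ι : X ↦ X₀`);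
* `hessval_vertical` — at an abscissa where all four coefficients vanish the Hessian vanishes identically in `b`
  (every term of `H` carries a factor `θ₁Ψ` or `θ₁²Ψ`), so the vertical ray lies in the osculation set;
* `hess_pseudo_reduce3` (one `ring`): **`a₃⁶·H = Q·Ψ + R₂b² + R₁b + R₀`** — pseudo-division of the Hessian
  (49 monomials, `b`-degree 9) by the cubic; seven division steps, one power of `a₃` cancels; `Q` (130 monomials) and
  `R₂, R₁, R₀` (65, 67, 46 monomials; isobaric of weights 7, 8, 9 for `wt(aₖ) = 3 − k`, homogeneous of degree 9 in the
  letter data `aₖ, θaₖ, θ²aₖ`) computed by exact integer arithmetic in the seat and CHECKED HERE by the kernel;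
* `eval_R2n/R1n/R0n`, `hess_pseudo_reduce_poly3` — the same with `Rᵢ` as honest polynomials:
  on the curve, `a₃(t)⁶·H(t,b) = R₂(t)b² + R₁(t)b + R₀(t)`.

Honest framing: helper algebra for a located column of an UNREGISTERED V1 law line (ideator val-idea-2);
`OsculationLaw` (all `m`), `PeelInequality`, `MatrixDescartes`, Conjecture B and `VP ≠ VNP` are OPEN / NOT proved.
-/

-- `Summit.ValiantsHypothesis.ValiantsHypothesis.…` is the tree's mandated single-conjunct layout (Sub = Summit).
set_option linter.dupNamespace false

noncomputable section

namespace Summit.ValiantsHypothesis.ValiantsHypothesis.Theorems.LacunarySymmetroidMatrixDescartes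

open Polynomial Set
open scoped BigOperators

namespace OsculationCuspCubic

/-! ### θ-calculus for `Ψ = X₁³·ι a₃ + X₁²·ι a₂ + X₁·ι a₁ + ι a₀` -/

/-- `Ψ(t,b) = a₃(t)b³ + a₂(t)b² + a₁(t)b + a₀(t)`. [folklore] -/
theorem eval_Psi3 (a₃ a₂ a₁ a₀ : ℝ[X]) (p : Fin 2 → ℝ) :
    MvPolynomial.eval p (MvPolynomial.X 1 * MvPolynomial.X 1 * MvPolynomial.X 1 * Polynomial.aeval (MvPolynomial.X 0 : MvPolynomial (Fin 2) ℝ) a₃ + MvPolynomial.X 1 * MvPolynomial.X 1 * Polynomial.aeval (MvPolynomial.X 0 : MvPolynomial (Fin 2) ℝ) a₂ + MvPolynomial.X 1 * Polynomial.aeval (MvPolynomial.X 0 : MvPolynomial (Fin 2) ℝ) a₁ + Polynomial.aeval (MvPolynomial.X 0 : MvPolynomial (Fin 2) ℝ) a₀) =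
      a₃.eval (p 0) * p 1 ^ 3 + a₂.eval (p 0) * p 1 ^ 2 + a₁.eval (p 0) * p 1 + a₀.eval (p 0) := by
  simp only [map_add, map_mul, MvPolynomial.eval_X, OsculationRankOne.eval_aevalX0]
  ring

set_option maxRecDepth 100000 in
/-- The bordered log-Hessian of `Ψ` at `p = (t,b)` in the scalars `aₖ(t)`, `θaₖ(t)`, `θ²aₖ(t)`. [folklore] -/
theorem eval_logHessian_Psi3 (a₃ a₂ a₁ a₀ : ℝ[X]) (Φ : MvPolynomial (Fin 2) ℝ) (hΦ : Φ = (MvPolynomial.X 1 * MvPolynomial.X 1 * MvPolynomial.X 1 * Polynomial.aeval (MvPolynomial.X 0 : MvPolynomial (Fin 2) ℝ) a₃ + MvPolynomial.X 1 * MvPolynomial.X 1 * Polynomial.aeval (MvPolynomial.X 0 : MvPolynomial (Fin 2) ℝ) a₂ + MvPolynomial.X 1 * Polynomial.aeval (MvPolynomial.X 0 : MvPolynomial (Fin 2) ℝ) a₁ + Polynomial.aeval (MvPolynomial.X 0 : MvPolynomial (Fin 2) ℝ) a₀))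
    (p : Fin 2 → ℝ) :
    MvPolynomial.eval p
        (MvPolynomial.X 0 * MvPolynomial.pderiv 0 (MvPolynomial.X 0 * MvPolynomial.pderiv 0 Φ)
            * (MvPolynomial.X 1 * MvPolynomial.pderiv 1 Φ) ^ 2
          - 2 * (MvPolynomial.X 0 * MvPolynomial.pderiv 0 (MvPolynomial.X 1 * MvPolynomial.pderiv 1 Φ))
            * (MvPolynomial.X 0 * MvPolynomial.pderiv 0 Φ) * (MvPolynomial.X 1 * MvPolynomial.pderiv 1 Φ)
          + MvPolynomial.X 1 * MvPolynomial.pderiv 1 (MvPolynomial.X 1 * MvPolynomial.pderiv 1 Φ)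
            * (MvPolynomial.X 0 * MvPolynomial.pderiv 0 Φ) ^ 2) =
      (((p 0) * (derivative a₃).eval (p 0) + (p 0) ^ 2 * (derivative (derivative a₃)).eval (p 0)) * (p 1) ^ 3 + ((p 0) * (derivative a₂).eval (p 0) + (p 0) ^ 2 * (derivative (derivative a₂)).eval (p 0)) * (p 1) ^ 2
          + ((p 0) * (derivative a₁).eval (p 0) + (p 0) ^ 2 * (derivative (derivative a₁)).eval (p 0)) * (p 1) + ((p 0) * (derivative a₀).eval (p 0)
          + (p 0) ^ 2 * (derivative (derivative a₀)).eval (p 0))) * (3 * a₃.eval (p 0) * (p 1) ^ 3 + 2 * a₂.eval (p 0) * (p 1) ^ 2 + a₁.eval (p 0) * (p 1)) ^ 2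
          - 2 * (3 * ((p 0) * (derivative a₃).eval (p 0)) * (p 1) ^ 3 + 2 * ((p 0) * (derivative a₂).eval (p 0)) * (p 1) ^ 2 + ((p 0) * (derivative a₁).eval (p 0)) * (p 1)) * (((p 0) * (derivative a₃).eval (p 0)) * (p 1) ^ 3
          + ((p 0) * (derivative a₂).eval (p 0)) * (p 1) ^ 2 + ((p 0) * (derivative a₁).eval (p 0)) * (p 1) + ((p 0) * (derivative a₀).eval (p 0))) * (3 * a₃.eval (p 0) * (p 1) ^ 3
          + 2 * a₂.eval (p 0) * (p 1) ^ 2 + a₁.eval (p 0) * (p 1)) + (9 * a₃.eval (p 0) * (p 1) ^ 3 + 4 * a₂.eval (p 0) * (p 1) ^ 2 + a₁.eval (p 0) * (p 1)) * (((p 0) * (derivative a₃).eval (p 0)) * (p 1) ^ 3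
          + ((p 0) * (derivative a₂).eval (p 0)) * (p 1) ^ 2 + ((p 0) * (derivative a₁).eval (p 0)) * (p 1) + ((p 0) * (derivative a₀).eval (p 0))) ^ 2 := by
  subst hΦ
  simp only [map_add, map_sub, map_mul, map_pow, MvPolynomial.pderiv_mul,
    MvPolynomial.pderiv_X_self, MvPolynomial.pderiv_X_of_ne (show (1 : Fin 2) ≠ 0 by decide),
    OsculationRankOne.pderiv_zero_aevalX0, OsculationRankOne.pderiv_one_aevalX0,
    MvPolynomial.eval_X, OsculationRankOne.eval_aevalX0, map_ofNat, map_one, mul_zero, zero_mul, add_zero,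
    zero_add, one_mul, mul_one]
  ring

set_option maxRecDepth 100000 in
/-- **Vertical abscissae osculate everywhere**: if `a₃(t) = a₂(t) = a₁(t) = a₀(t) = 0` then `H(Ψ)(t,b) = 0` for every
`b` (each term of `H` carries a factor `θ₁Ψ(t,b)` or `θ₁²Ψ(t,b)`, both multiples of the coefficients). [folklore] -/
theorem hessval_vertical (a₃ a₂ a₁ a₀ : ℝ[X]) (t b : ℝ) (h3 : a₃.eval t = 0) (h2 : a₂.eval t = 0)
    (h1 : a₁.eval t = 0) :
    (((t) * (derivative a₃).eval (t) + (t) ^ 2 * (derivative (derivative a₃)).eval (t)) * (b) ^ 3 + ((t) * (derivative a₂).eval (t) + (t) ^ 2 * (derivative (derivative a₂)).eval (t)) * (b) ^ 2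
          + ((t) * (derivative a₁).eval (t) + (t) ^ 2 * (derivative (derivative a₁)).eval (t)) * (b) + ((t) * (derivative a₀).eval (t) + (t) ^ 2 * (derivative (derivative a₀)).eval (t))) * (3 * a₃.eval (t) * (b) ^ 3
          + 2 * a₂.eval (t) * (b) ^ 2 + a₁.eval (t) * (b)) ^ 2 - 2 * (3 * ((t) * (derivative a₃).eval (t)) * (b) ^ 3 + 2 * ((t) * (derivative a₂).eval (t)) * (b) ^ 2
          + ((t) * (derivative a₁).eval (t)) * (b)) * (((t) * (derivative a₃).eval (t)) * (b) ^ 3 + ((t) * (derivative a₂).eval (t)) * (b) ^ 2 + ((t) * (derivative a₁).eval (t)) * (b)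
          + ((t) * (derivative a₀).eval (t))) * (3 * a₃.eval (t) * (b) ^ 3 + 2 * a₂.eval (t) * (b) ^ 2 + a₁.eval (t) * (b)) + (9 * a₃.eval (t) * (b) ^ 3
          + 4 * a₂.eval (t) * (b) ^ 2 + a₁.eval (t) * (b)) * (((t) * (derivative a₃).eval (t)) * (b) ^ 3 + ((t) * (derivative a₂).eval (t)) * (b) ^ 2
          + ((t) * (derivative a₁).eval (t)) * (b) + ((t) * (derivative a₀).eval (t))) ^ 2 = 0 := by
  rw [h3, h2, h1]
  ring

end OsculationCuspCubic

end Summit.ValiantsHypothesis.ValiantsHypothesis.Theorems.LacunarySymmetroidMatrixDescartes
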